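import Mathlib

/-!
# Stub `stub_coeffMulBound` for line `Sketch-ideate-r1-k1` (crux stmt-Langlands-8485)

Ultrametric product rule for coefficientwise sup-norm bounds on power series: over a normed
field whose norm is ultrametric (in particular over `PadicAlgCl p = AlgebraicClosure ℚ_[p]`
with the spectral norm), if every coefficient of `φ` has norm `≤ A` and every coefficient of
`ψ` has norm `≤ B` (with `0 ≤ A`, `0 ≤ B`), then every coefficient of `φ * ψ` has norm
`≤ A * B`.  Each coefficient of the product is a finite sum over the antidiagonal of products
of coefficients (`PowerSeries.coeff_mul`), each of norm `≤ A * B`, and the ultrametric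
inequality bounds a finite sum by the maximum of its terms
(`IsUltrametricDist.norm_sum_le_of_forall_le_of_nonneg`).
-/

noncomputable section

set_option linter.dupNamespace false -- `Summit.Langlands.Langlands` is the mandated namespace

namespace Summit.Langlands.Langlands.Theorems.HilbertIntegralOverconvergentIsCongruence

/-- **Ultrametric product rule for coefficient bounds (general form).**  Over a normed field `K`
with an ultrametric norm: if `‖coeff n φ‖ ≤ A` and `‖coeff n ψ‖ ≤ B` for all `n`, with
`0 ≤ A` and `0 ≤ B`, then `‖coeff n (φ * ψ)‖ ≤ A * B` for all `n`. -/
theorem norm_coeff_mul_le_of_forall_le {K : Type*} [NormedField K] [IsUltrametricDist K]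
    (φ ψ : PowerSeries K) {A B : ℝ} (hA : 0 ≤ A) (hB : 0 ≤ B)
    (hφ : ∀ n, ‖PowerSeries.coeff n φ‖ ≤ A) (hψ : ∀ n, ‖PowerSeries.coeff n ψ‖ ≤ B) (n : ℕ) :
    ‖PowerSeries.coeff n (φ * ψ)‖ ≤ A * B := by
  rw [PowerSeries.coeff_mul]
  refine IsUltrametricDist.norm_sum_le_of_forall_le_of_nonneg (mul_nonneg hA hB) fun x _ => ?_
  rw [norm_mul]
  exact mul_le_mul (hφ x.1) (hψ x.2) (norm_nonneg _) hA

/-- **stub 3 — `stub_coeffMulBound`.**  Ultrametric bound for the coefficients of a product of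
power series over `PadicAlgCl p`: coefficientwise `‖φ‖ ≤ A`, `‖ψ‖ ≤ B` (with `0 ≤ A`, `0 ≤ B`)
give coefficientwise `‖φ ψ‖ ≤ A B` (each coefficient is a finite sum of products; the norm on
`PadicAlgCl p` is nonarchimedean, `PadicAlgCl.isUltrametricDist`). -/
theorem stub_coeffMulBound :
    ∀ (p : ℕ) [Fact p.Prime] (φ ψ : PowerSeries (PadicAlgCl p)) (A B : ℝ), 0 ≤ A → 0 ≤ B →
      (∀ n, ‖PowerSeries.coeff n φ‖ ≤ A) → (∀ n, ‖PowerSeries.coeff n ψ‖ ≤ B) →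
      ∀ n, ‖PowerSeries.coeff n (φ * ψ)‖ ≤ A * B :=
  fun _ _ φ ψ _ _ hA hB hφ hψ n => norm_coeff_mul_le_of_forall_le φ ψ hA hB hφ hψ n

end Summit.Langlands.Langlands.Theorems.HilbertIntegralOverconvergentIsCongruence

end
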